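import Summits.BirchSwinnertonDyer.BirchSwinnertonDyer.Theorems.BiquadraticEisensteinDescentHeegnerTwistCouplingInSupplySymbolicMonskyDesignRows
import HarnessLib

set_option linter.dupNamespace false -- `Summit.BirchSwinnertonDyer.BirchSwinnertonDyer.Theorems.…` (summit = sub)
set_option autoImplicit false

/-!
# Crux `HeegnerTwistCouplingInSupply` (stmt-BirchSwinnertonDyer-21381) — Z-DESIGNS with any number of free cells, part 2: the left-kernel
# pairing, the core (stages `w`, `u` at once) and injectivity on `Q`-constant vectors

Route `BiquadraticEisensteinDescent` (cell `pub/bsd-wall`, width seat `bsd-wall-cm-bed-w3` g22; `--supports` 21381, helper). File (2/3) of the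
general-`τ` DESIGN CRITERION (memo w3g22 THEOREM-A; generalises `…SymbolicMonskyTwoPrimeCore`, the case `τ = 1`).

Setting: base datum `base : SymbData (k+1)`; cells `c₁ :: rest` (`c₁ ≡ 3 (4)` with bits `m + Σσ_i` and `(2/·)`-class `Σ d'_i`; the free cells
`rest_i ≡ 1 (4)` with bits `σ_i` (as `𝔽₂`-vectors `σ i`) and `(2/·)`-classes `d'_i = dp i`); reference matrix `M` (all mutual symbols `+1`).
Virtual kernel pairs `(x, y)` of the base: `(L + D_m)x + D_d y = 0`, `D_m x + L y = 0`.

* ★ `design_pairing`: for `z` killed by the base rows and the two auxiliary row-sums and ANY virtual kernel pair `(x, y)`: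
  `Σ_i (a_i ⟨σ_i, y⟩ + e_i ⟨σ_i, x⟩) = 0` (`a_i`, `e_i` the `u`- and `w`-differences of `z` on the auxiliary block) — the left-kernel pairing of
  `…SymbolicMonskyLeftKernel` applied to the design identities (D1), (D2) of part 1.
* ★ `design_core`: if moreover the pairs `(⟨σ_i, y⟩, ⟨σ_i, x⟩)_{(x,y) ∈ 𝒦}` together with `(c_i, d'_i)` SPAN `𝔽₂^τ × 𝔽₂^τ` (hypothesis `hspan`:
  the only `(a, e)` orthogonal to all of them is `0`), then `a = e = 0`: `z` is constant on the auxiliary block in the directions `u` AND `w`.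
* ★ `design_S3`: if `(x, y, γ) ↦ (⟨σ_i, x⟩ + γ d'_i, ⟨σ_i, y⟩ + γ c_i)_i` is injective on `𝒦 ⊕ 𝔽₂·(δ,1)` (hypothesis `hF`), then `M` kills no
  non-zero `Q`-constant vector.

HONEST FRAMING: linear algebra over `𝔽₂`; the crux (C⁺), its registered stubs and BSD are untouched; nothing is closed. THEOREMS ONLY.
Reference: [HeathBrown1994] appendix (Monsky), typescript pp. 39–41.
-/

namespace Summit.BirchSwinnertonDyer.BirchSwinnertonDyer.Theorems.SymbolicMonsky

section DesignCore

open Matrix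

variable {k : ℕ} (base : SymbData (k + 1)) (c₁ : AuxCell) (rest : List AuxCell)

/-- ★ **The left-kernel pairing of a design.** See the module docstring. [folklore] -/
theorem design_pairing (hm1 : negNegOne c₁.1 = true) (hmr : ∀ i : Fin rest.length, negNegOne (rest.getD i.val (0, 0)).1 = false)
    (σ : Fin rest.length → Fin (k + 1) → ZMod 2) (hσ : ∀ i b, bz ((rest.getD i.val (0, 0)).2.testBit b.val) = σ i b)
    (hσ1 : ∀ b : Fin (k + 1), bz (c₁.2.testBit b.val) = bz (negNegOne (base.cls b)) + ∑ i, σ i b)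
    (dp : Fin rest.length → ZMod 2) (hdp : ∀ i, bz (negTwo (rest.getD i.val (0, 0)).1) = dp i)
    (hd1 : bz (negTwo c₁.1) = ∑ i, dp i)
    (z : Fin (k + 1 + (c₁ :: rest).length) ⊕ Fin (k + 1 + (c₁ :: rest).length) → ZMod 2)
    (hrow1 : ∀ b : Fin (k + 1), ((dataK base (c₁ :: rest) (fun _ _ => false)).monskyOddS *ᵥ z) (Sum.inl (Fin.castAdd _ b)) = 0)
    (hrow2 : ∀ b : Fin (k + 1), ((dataK base (c₁ :: rest) (fun _ _ => false)).monskyOddS *ᵥ z) (Sum.inr (Fin.castAdd _ b)) = 0)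
    (hs1 : (∑ j : Fin (c₁ :: rest).length,
      ((dataK base (c₁ :: rest) (fun _ _ => false)).monskyOddS *ᵥ z) (Sum.inl (Fin.natAdd (k + 1) j))) = 0)
    (hs2 : (∑ j : Fin (c₁ :: rest).length,
      ((dataK base (c₁ :: rest) (fun _ _ => false)).monskyOddS *ᵥ z) (Sum.inr (Fin.natAdd (k + 1) j))) = 0)
    (x y : Fin (k + 1) → ZMod 2)
    (hE1 : ∀ i, (∑ j, bz (base.neg i j) * (x j + x i)) + bz (negNegOne (base.cls i)) * x i + bz (negTwo (base.cls i)) * y i = 0)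
    (hE2 : ∀ i, bz (negNegOne (base.cls i)) * x i + ∑ j, bz (base.neg i j) * (y j + y i) = 0) :
    (∑ i : Fin rest.length,
      ((z (Sum.inl (Fin.natAdd (k + 1) (⟨i.val + 1, by simp⟩ : Fin (c₁ :: rest).length))) + z (Sum.inl (Fin.natAdd (k + 1) (⟨0, by simp⟩ : Fin (c₁ :: rest).length)))) * (∑ b, σ i b * y b) +
        ((z (Sum.inl (Fin.natAdd (k + 1) (⟨i.val + 1, by simp⟩ : Fin (c₁ :: rest).length))) + z (Sum.inr (Fin.natAdd (k + 1) (⟨i.val + 1, by simp⟩ : Fin (c₁ :: rest).length)))) +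
          (z (Sum.inl (Fin.natAdd (k + 1) (⟨0, by simp⟩ : Fin (c₁ :: rest).length))) + z (Sum.inr (Fin.natAdd (k + 1) (⟨0, by simp⟩ : Fin (c₁ :: rest).length))))) * (∑ b, σ i b * x b))) = 0 := by
  set q0 : Fin (c₁ :: rest).length := ⟨0, by simp⟩ with hq0
  set U0 := z (Sum.inl (Fin.natAdd (k + 1) q0)) with hU0
  set V0 := z (Sum.inr (Fin.natAdd (k + 1) q0)) with hV0
  set U : Fin rest.length → ZMod 2 := fun i => z (Sum.inl (Fin.natAdd (k + 1) (⟨i.val + 1, by simp⟩ : Fin (c₁ :: rest).length))) with hU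
  set V : Fin rest.length → ZMod 2 := fun i => z (Sum.inr (Fin.natAdd (k + 1) (⟨i.val + 1, by simp⟩ : Fin (c₁ :: rest).length))) with hV
  set u : Fin (k + 1) → ZMod 2 := fun b => z (Sum.inl (Fin.castAdd (c₁ :: rest).length b)) with hu
  set v : Fin (k + 1) → ZMod 2 := fun b => z (Sum.inr (Fin.castAdd (c₁ :: rest).length b)) with hv
  obtain ⟨D1, D2, D3, D4⟩ := design_identities base c₁ rest hm1 hmr σ hσ hσ1 dp hdp hd1 z hrow1 hrow2 hs1 hs2
  -- the pairing with (x, y) applied to (ũ, w)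
  have P := SymbData.leftKernel_pairing base x y hE1 hE2 (fun b => u b + U0) (fun b => u b + v b)
  have D1' : ∀ b : Fin (k + 1), (∑ b', bz (base.neg b b') * ((u b' + U0) + (u b + U0))) +
      bz (negNegOne (base.cls b)) * (u b + U0) + bz (negTwo (base.cls b)) * (u b + v b) = ∑ i, σ i b * (U i + U0) := D1
  have D2' : ∀ b : Fin (k + 1), bz (negNegOne (base.cls b)) * (u b + U0) + (∑ b', bz (base.neg b b') * ((u b' + v b') + (u b + v b))) =
      (∑ i, (∑ b', σ i b') * ((U i + V i) + (U0 + V0))) * bz (negNegOne (base.cls b)) + ∑ i, σ i b * ((U i + V i) + (U0 + V0)) := D2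
  simp only [D1', D2'] at P
  have t3 := SymbData.inner_m_eq base x y hE2
  set γ := ∑ l, bz (negNegOne (base.cls l)) * y l with hγ
  set μ := ∑ i, bz (negNegOne (base.cls i)) with hμ
  set E : Fin rest.length → ZMod 2 := fun i => (U i + V i) + (U0 + V0) with hE
  set CE := ∑ i, (∑ b', σ i b') * E i with hCE
  -- swapping lemmas
  have swap : ∀ (g : Fin (k + 1) → ZMod 2) (F : Fin rest.length → ZMod 2),
      (∑ b, g b * ∑ i, σ i b * F i) = ∑ i, F i * ∑ b, σ i b * g b := by
    intro g F
    have e : (∑ b, g b * ∑ i, σ i b * F i) = ∑ b, ∑ i, g b * (σ i b * F i) :=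
      Finset.sum_congr rfl fun b _ => Finset.mul_sum _ _ _
    rw [e, Finset.sum_comm]
    refine Finset.sum_congr rfl fun i _ => ?_
    rw [Finset.mul_sum]
    exact Finset.sum_congr rfl fun b _ => by ring
  have swapC : (∑ b : Fin (k + 1), ∑ i, σ i b * E i) = CE := by
    rw [hCE, Finset.sum_comm]
    exact Finset.sum_congr rfl fun i _ => by rw [Finset.sum_mul]
  have F1 : (∑ b, y b * ∑ i, σ i b * (U i + U0)) = ∑ i, (U i + U0) * ∑ b, σ i b * y b := swap y (fun i => U i + U0)
  have F2 : (∑ b, (x b + γ) * (CE * bz (negNegOne (base.cls b)) + ∑ i, σ i b * E i)) =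
      CE * (∑ b, bz (negNegOne (base.cls b)) * x b) + γ * (CE * μ) + (∑ i, E i * ∑ b, σ i b * x b) + γ * CE := by
    have e : ∀ b : Fin (k + 1), (x b + γ) * (CE * bz (negNegOne (base.cls b)) + ∑ i, σ i b * E i) =
        CE * (bz (negNegOne (base.cls b)) * x b) + γ * (CE * bz (negNegOne (base.cls b))) + x b * (∑ i, σ i b * E i) +
          γ * (∑ i, σ i b * E i) := fun b => by ring
    rw [Finset.sum_congr rfl (fun b _ => e b), Finset.sum_add_distrib, Finset.sum_add_distrib, Finset.sum_add_distrib,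
      ← Finset.mul_sum, ← Finset.mul_sum, ← Finset.mul_sum, ← Finset.mul_sum, swap x E, swapC, hμ]
  rw [F1, F2] at P
  have hX : (∑ b, bz (negNegOne (base.cls b)) * x b) = (μ + 1) * γ := t3
  rw [hX] at P
  show (∑ i, ((U i + U0) * (∑ b, σ i b * y b) + E i * (∑ b, σ i b * x b))) = 0
  rw [Finset.sum_add_distrib]
  set Ay := ∑ i, (U i + U0) * ∑ b, σ i b * y b with hAy
  set Ax := ∑ i, E i * ∑ b, σ i b * x b with hAx
  linear_combination (norm := skip) P
  ring_nf
  try reduce_mod_char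

/-- ★ **Core of a design** (stages `w` and `u` of the closure criterion at once). If the evaluation pairs `(⟨σ_i,y⟩, ⟨σ_i,x⟩)` over the virtual
kernel together with `(c_i, d'_i)` span `𝔽₂^τ × 𝔽₂^τ` (`hspan`), then every `z` killed by the base rows and the two auxiliary row-sums of the
reference matrix is constant on the auxiliary block in the directions `u` and `w`, the `q₁`-coordinate of half two vanishes, and the base part
`(u_B + u(q₁)1, u_B + v_B)` is a virtual kernel pair. [folklore] -/
theorem design_core (hm1 : negNegOne c₁.1 = true) (hmr : ∀ i : Fin rest.length, negNegOne (rest.getD i.val (0, 0)).1 = false)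
    (σ : Fin rest.length → Fin (k + 1) → ZMod 2) (hσ : ∀ i b, bz ((rest.getD i.val (0, 0)).2.testBit b.val) = σ i b)
    (hσ1 : ∀ b : Fin (k + 1), bz (c₁.2.testBit b.val) = bz (negNegOne (base.cls b)) + ∑ i, σ i b)
    (dp : Fin rest.length → ZMod 2) (hdp : ∀ i, bz (negTwo (rest.getD i.val (0, 0)).1) = dp i)
    (hd1 : bz (negTwo c₁.1) = ∑ i, dp i)
    (hspan : ∀ a e : Fin rest.length → ZMod 2,
      (∀ x y : Fin (k + 1) → ZMod 2, (∀ i, (∑ j, bz (base.neg i j) * (x j + x i)) + bz (negNegOne (base.cls i)) * x i + bz (negTwo (base.cls i)) * y i = 0) →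
        (∀ i, bz (negNegOne (base.cls i)) * x i + ∑ j, bz (base.neg i j) * (y j + y i) = 0) →
        (∑ i, (a i * (∑ b, σ i b * y b) + e i * (∑ b, σ i b * x b))) = 0) →
      (∑ i, ((∑ b, σ i b) * a i + dp i * e i)) = 0 → (∀ i, a i = 0) ∧ (∀ i, e i = 0))
    (z : Fin (k + 1 + (c₁ :: rest).length) ⊕ Fin (k + 1 + (c₁ :: rest).length) → ZMod 2)
    (hrow1 : ∀ b : Fin (k + 1), ((dataK base (c₁ :: rest) (fun _ _ => false)).monskyOddS *ᵥ z) (Sum.inl (Fin.castAdd _ b)) = 0)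
    (hrow2 : ∀ b : Fin (k + 1), ((dataK base (c₁ :: rest) (fun _ _ => false)).monskyOddS *ᵥ z) (Sum.inr (Fin.castAdd _ b)) = 0)
    (hs1 : (∑ j : Fin (c₁ :: rest).length,
      ((dataK base (c₁ :: rest) (fun _ _ => false)).monskyOddS *ᵥ z) (Sum.inl (Fin.natAdd (k + 1) j))) = 0)
    (hs2 : (∑ j : Fin (c₁ :: rest).length,
      ((dataK base (c₁ :: rest) (fun _ _ => false)).monskyOddS *ᵥ z) (Sum.inr (Fin.natAdd (k + 1) j))) = 0) :
    (∀ i : Fin rest.length, z (Sum.inl (Fin.natAdd (k + 1) (⟨i.val + 1, by simp⟩ : Fin (c₁ :: rest).length))) = z (Sum.inl (Fin.natAdd (k + 1) (⟨0, by simp⟩ : Fin (c₁ :: rest).length)))) ∧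
    (∀ i : Fin rest.length, z (Sum.inl (Fin.natAdd (k + 1) (⟨i.val + 1, by simp⟩ : Fin (c₁ :: rest).length))) + z (Sum.inr (Fin.natAdd (k + 1) (⟨i.val + 1, by simp⟩ : Fin (c₁ :: rest).length))) =
      z (Sum.inl (Fin.natAdd (k + 1) (⟨0, by simp⟩ : Fin (c₁ :: rest).length))) + z (Sum.inr (Fin.natAdd (k + 1) (⟨0, by simp⟩ : Fin (c₁ :: rest).length)))) ∧
    z (Sum.inr (Fin.natAdd (k + 1) (⟨0, by simp⟩ : Fin (c₁ :: rest).length))) = 0 ∧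
    (∀ b : Fin (k + 1), (∑ b', bz (base.neg b b') * ((z (Sum.inl (Fin.castAdd _ b')) + z (Sum.inl (Fin.natAdd (k + 1) (⟨0, by simp⟩ : Fin (c₁ :: rest).length)))) +
        (z (Sum.inl (Fin.castAdd _ b)) + z (Sum.inl (Fin.natAdd (k + 1) (⟨0, by simp⟩ : Fin (c₁ :: rest).length)))))) +
      bz (negNegOne (base.cls b)) * (z (Sum.inl (Fin.castAdd _ b)) + z (Sum.inl (Fin.natAdd (k + 1) (⟨0, by simp⟩ : Fin (c₁ :: rest).length)))) +
      bz (negTwo (base.cls b)) * (z (Sum.inl (Fin.castAdd _ b)) + z (Sum.inr (Fin.castAdd _ b))) = 0) ∧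
    (∀ b : Fin (k + 1), bz (negNegOne (base.cls b)) * (z (Sum.inl (Fin.castAdd _ b)) + z (Sum.inl (Fin.natAdd (k + 1) (⟨0, by simp⟩ : Fin (c₁ :: rest).length)))) +
      (∑ b', bz (base.neg b b') * ((z (Sum.inl (Fin.castAdd _ b')) + z (Sum.inr (Fin.castAdd _ b'))) +
        (z (Sum.inl (Fin.castAdd _ b)) + z (Sum.inr (Fin.castAdd _ b))))) = 0) := by
  set q0 : Fin (c₁ :: rest).length := ⟨0, by simp⟩ with hq0
  set U0 := z (Sum.inl (Fin.natAdd (k + 1) q0)) with hU0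
  set V0 := z (Sum.inr (Fin.natAdd (k + 1) q0)) with hV0
  set U : Fin rest.length → ZMod 2 := fun i => z (Sum.inl (Fin.natAdd (k + 1) (⟨i.val + 1, by simp⟩ : Fin (c₁ :: rest).length))) with hU
  set V : Fin rest.length → ZMod 2 := fun i => z (Sum.inr (Fin.natAdd (k + 1) (⟨i.val + 1, by simp⟩ : Fin (c₁ :: rest).length))) with hV
  set u : Fin (k + 1) → ZMod 2 := fun b => z (Sum.inl (Fin.castAdd (c₁ :: rest).length b)) with hu
  set v : Fin (k + 1) → ZMod 2 := fun b => z (Sum.inr (Fin.castAdd (c₁ :: rest).length b)) with hv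
  obtain ⟨D1, D2, D3, D4⟩ := design_identities base c₁ rest hm1 hmr σ hσ hσ1 dp hdp hd1 z hrow1 hrow2 hs1 hs2
  have Pr : ∀ x y : Fin (k + 1) → ZMod 2, (∀ i, (∑ j, bz (base.neg i j) * (x j + x i)) + bz (negNegOne (base.cls i)) * x i + bz (negTwo (base.cls i)) * y i = 0) →
      (∀ i, bz (negNegOne (base.cls i)) * x i + ∑ j, bz (base.neg i j) * (y j + y i) = 0) →
      (∑ i, ((U i + U0) * (∑ b, σ i b * y b) + (((U i + V i) + (U0 + V0)) * (∑ b, σ i b * x b)))) = 0 :=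
    fun x y hE1 hE2 => design_pairing base c₁ rest hm1 hmr σ hσ hσ1 dp hdp hd1 z hrow1 hrow2 hs1 hs2 x y hE1 hE2
  have D3' : (∑ i, ((∑ b, σ i b) * (U i + U0) + dp i * ((U i + V i) + (U0 + V0)))) = 0 := D3
  obtain ⟨ha, he⟩ := hspan (fun i => U i + U0) (fun i => (U i + V i) + (U0 + V0)) Pr D3'
  have ha' : ∀ i, U i = U0 := fun i => (zmod_two_eq_iff_add_eq_zero _ _).mpr (ha i)
  have he' : ∀ i, U i + V i = U0 + V0 := fun i => (zmod_two_eq_iff_add_eq_zero _ _).mpr (he i)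
  have hV0 : V0 = 0 := by
    have h : V0 = ∑ i, (∑ b', σ i b') * ((U i + V i) + (U0 + V0)) := D4
    rw [h]
    exact Finset.sum_eq_zero fun i _ => by rw [he i, mul_zero]
  refine ⟨ha', he', hV0, fun b => ?_, fun b => ?_⟩
  · have h : (∑ b', bz (base.neg b b') * ((u b' + U0) + (u b + U0))) + bz (negNegOne (base.cls b)) * (u b + U0) +
        bz (negTwo (base.cls b)) * (u b + v b) = ∑ i, σ i b * (U i + U0) := D1 b
    rw [h]
    exact Finset.sum_eq_zero fun i _ => by rw [ha i, mul_zero]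
  · have h : bz (negNegOne (base.cls b)) * (u b + U0) + (∑ b', bz (base.neg b b') * ((u b' + v b') + (u b + v b))) =
        (∑ i, (∑ b', σ i b') * ((U i + V i) + (U0 + V0))) * bz (negNegOne (base.cls b)) + ∑ i, σ i b * ((U i + V i) + (U0 + V0)) := D2 b
    rw [h]
    have h0 : (∑ i, (∑ b', σ i b') * ((U i + V i) + (U0 + V0))) = 0 :=
      Finset.sum_eq_zero fun i _ => by rw [he i, mul_zero]
    rw [h0, zero_mul, zero_add]
    exact Finset.sum_eq_zero fun i _ => by rw [he i, mul_zero]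

/-- ★ **Injectivity on `Q`-constant vectors** (stage S3) for a design: if `(x, y, γ) ↦ (⟨σ_i,x⟩ + γ d'_i, ⟨σ_i,y⟩ + γ c_i)_i` is injective
on (virtual kernel pairs) `⊕ 𝔽₂` (`hF`, i.e. `(𝒦 ⊕ ⟨(δ,1)⟩) ∩ (Z ⊕ Z) = 0`), the reference matrix kills no non-zero vector that is constant on
the auxiliary block in both halves. [folklore] -/
theorem design_S3 (hm1 : negNegOne c₁.1 = true) (hmr : ∀ i : Fin rest.length, negNegOne (rest.getD i.val (0, 0)).1 = false)
    (σ : Fin rest.length → Fin (k + 1) → ZMod 2) (hσ : ∀ i b, bz ((rest.getD i.val (0, 0)).2.testBit b.val) = σ i b)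
    (hσ1 : ∀ b : Fin (k + 1), bz (c₁.2.testBit b.val) = bz (negNegOne (base.cls b)) + ∑ i, σ i b)
    (dp : Fin rest.length → ZMod 2) (hdp : ∀ i, bz (negTwo (rest.getD i.val (0, 0)).1) = dp i)
    (hd1 : bz (negTwo c₁.1) = ∑ i, dp i)
    (hF : ∀ (x y : Fin (k + 1) → ZMod 2) (γ : ZMod 2), (∀ i, (∑ j, bz (base.neg i j) * (x j + x i)) + bz (negNegOne (base.cls i)) * x i + bz (negTwo (base.cls i)) * y i = 0) →
        (∀ i, bz (negNegOne (base.cls i)) * x i + ∑ j, bz (base.neg i j) * (y j + y i) = 0) →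
        (∀ i, (∑ b, σ i b * x b) + γ * dp i = 0) → (∀ i, (∑ b, σ i b * y b) + γ * ∑ b, σ i b = 0) →
        γ = 0 ∧ x = 0 ∧ y = 0)
    (z : Fin (k + 1 + (c₁ :: rest).length) ⊕ Fin (k + 1 + (c₁ :: rest).length) → ZMod 2)
    (hconst : ∀ i j, auxQ k (c₁ :: rest).length i = true → auxQ k (c₁ :: rest).length j = true →
      z (Sum.inl i) = z (Sum.inl j) ∧ z (Sum.inr i) = z (Sum.inr j))
    (hz : (dataK base (c₁ :: rest) (fun _ _ => false)).monskyOddS *ᵥ z = 0) : z = 0 := by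
  set q0 : Fin (c₁ :: rest).length := ⟨0, by simp⟩ with hq0
  set U0 := z (Sum.inl (Fin.natAdd (k + 1) q0)) with hU0
  set V0 := z (Sum.inr (Fin.natAdd (k + 1) q0)) with hV0
  set U : Fin rest.length → ZMod 2 := fun i => z (Sum.inl (Fin.natAdd (k + 1) (⟨i.val + 1, by simp⟩ : Fin (c₁ :: rest).length))) with hU
  set V : Fin rest.length → ZMod 2 := fun i => z (Sum.inr (Fin.natAdd (k + 1) (⟨i.val + 1, by simp⟩ : Fin (c₁ :: rest).length))) with hV
  set u : Fin (k + 1) → ZMod 2 := fun b => z (Sum.inl (Fin.castAdd (c₁ :: rest).length b)) with hu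
  set v : Fin (k + 1) → ZMod 2 := fun b => z (Sum.inr (Fin.castAdd (c₁ :: rest).length b)) with hv
  have hrow1 : ∀ b : Fin (k + 1), ((dataK base (c₁ :: rest) (fun _ _ => false)).monskyOddS *ᵥ z) (Sum.inl (Fin.castAdd _ b)) = 0 :=
    fun b => by rw [hz]; rfl
  have hrow2 : ∀ b : Fin (k + 1), ((dataK base (c₁ :: rest) (fun _ _ => false)).monskyOddS *ᵥ z) (Sum.inr (Fin.castAdd _ b)) = 0 :=
    fun b => by rw [hz]; rfl
  have hA : ∀ j, ((dataK base (c₁ :: rest) (fun _ _ => false)).monskyOddS *ᵥ z) (Sum.inl (Fin.natAdd (k + 1) j)) = 0 :=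
    fun j => by rw [hz]; rfl
  have hB : ∀ j, ((dataK base (c₁ :: rest) (fun _ _ => false)).monskyOddS *ᵥ z) (Sum.inr (Fin.natAdd (k + 1) j)) = 0 :=
    fun j => by rw [hz]; rfl
  obtain ⟨D1, D2, -, D4⟩ := design_identities base c₁ rest hm1 hmr σ hσ hσ1 dp hdp hd1 z hrow1 hrow2
    (Finset.sum_eq_zero fun j _ => hA j) (Finset.sum_eq_zero fun j _ => hB j)
  -- constancy on the auxiliary block
  have hcU : ∀ i, U i = U0 := fun i =>
    (hconst (Fin.natAdd (k + 1) (⟨i.val + 1, by simp⟩ : Fin (c₁ :: rest).length)) (Fin.natAdd (k + 1) q0)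
      (auxQ_natAdd _ _) (auxQ_natAdd _ _)).1
  have hcV : ∀ i, V i = V0 := fun i =>
    (hconst (Fin.natAdd (k + 1) (⟨i.val + 1, by simp⟩ : Fin (c₁ :: rest).length)) (Fin.natAdd (k + 1) q0)
      (auxQ_natAdd _ _) (auxQ_natAdd _ _)).2
  have he0 : ∀ i, (U i + V i) + (U0 + V0) = 0 := fun i => by
    rw [hcU i, hcV i]; exact zmod_two_add_self _
  have hV00 : V0 = 0 := by
    have h : V0 = ∑ i, (∑ b', σ i b') * ((U i + V i) + (U0 + V0)) := D4
    rw [h]; exact Finset.sum_eq_zero fun i _ => by rw [he0 i, mul_zero]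
  -- the base pair (ũ, w) is a virtual kernel pair
  have hE1 : ∀ b, (∑ b', bz (base.neg b b') * ((u b' + U0) + (u b + U0))) + bz (negNegOne (base.cls b)) * (u b + U0) +
      bz (negTwo (base.cls b)) * (u b + v b) = 0 := by
    intro b
    have h : (∑ b', bz (base.neg b b') * ((u b' + U0) + (u b + U0))) + bz (negNegOne (base.cls b)) * (u b + U0) +
        bz (negTwo (base.cls b)) * (u b + v b) = ∑ i, σ i b * (U i + U0) := D1 b
    rw [h]; exact Finset.sum_eq_zero fun i _ => by rw [hcU i, zmod_two_add_self, mul_zero]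
  have hE2 : ∀ b, bz (negNegOne (base.cls b)) * (u b + U0) + (∑ b', bz (base.neg b b') * ((u b' + v b') + (u b + v b))) = 0 := by
    intro b
    have h : bz (negNegOne (base.cls b)) * (u b + U0) + (∑ b', bz (base.neg b b') * ((u b' + v b') + (u b + v b))) =
        (∑ i, (∑ b', σ i b') * ((U i + V i) + (U0 + V0))) * bz (negNegOne (base.cls b)) + ∑ i, σ i b * ((U i + V i) + (U0 + V0)) := D2 b
    rw [h]
    have h0 : (∑ i, (∑ b', σ i b') * ((U i + V i) + (U0 + V0))) = 0 :=
      Finset.sum_eq_zero fun i _ => by rw [he0 i, mul_zero]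
    rw [h0, zero_mul, zero_add]
    exact Finset.sum_eq_zero fun i _ => by rw [he0 i, mul_zero]
  -- the rows of the free cells
  have T1 : ∀ i : Fin rest.length, (∑ b, σ i b * (u b + U0)) + U0 * dp i = 0 := by
    intro i
    have h := hA ⟨i.val + 1, by simp⟩
    rw [mulVec_inl_natAdd_expand, sum_bz_neg_aux_aux_design base c₁ rest hmr, add_zero] at h
    simp only [bz_neg_tail_castAdd base c₁ rest hmr σ hσ, List.getD_cons_succ, hdp] at h
    have hUi : z (Sum.inl (Fin.natAdd (k + 1) (⟨i.val + 1, by simp⟩ : Fin (c₁ :: rest).length))) = U0 := hcU i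
    have hVi : z (Sum.inr (Fin.natAdd (k + 1) (⟨i.val + 1, by simp⟩ : Fin (c₁ :: rest).length))) = 0 := (hcV i).trans hV00
    rw [hUi, hVi] at h
    simp only [add_zero] at h
    have h' : (∑ b, σ i b * (u b + U0)) + dp i * U0 = 0 := h
    rw [mul_comm U0 (dp i)]
    exact h'
  have T2 : ∀ i : Fin rest.length, (∑ b, σ i b * (u b + v b)) + U0 * ∑ b, σ i b = 0 := by
    intro i
    have h := hB ⟨i.val + 1, by simp⟩
    rw [mulVec_inr_natAdd_expand, sum_bz_neg_aux_aux_design base c₁ rest hmr, add_zero] at h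
    simp only [bz_neg_tail_castAdd base c₁ rest hmr σ hσ, List.getD_cons_succ, hdp] at h
    have hUi : z (Sum.inl (Fin.natAdd (k + 1) (⟨i.val + 1, by simp⟩ : Fin (c₁ :: rest).length))) = U0 := hcU i
    have hVi : z (Sum.inr (Fin.natAdd (k + 1) (⟨i.val + 1, by simp⟩ : Fin (c₁ :: rest).length))) = 0 := (hcV i).trans hV00
    rw [hUi, hVi] at h
    simp only [add_zero, mul_zero] at h
    have h' : dp i * U0 + (∑ b, σ i b * v b) = 0 := h
    have t1 := T1 i
    have e1 : (∑ b, σ i b * (u b + U0)) = (∑ b, σ i b * u b) + (∑ b, σ i b) * U0 := sum_mul_add_const (σ i) u U0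
    have e2 : (∑ b, σ i b * (u b + v b)) = (∑ b, σ i b * u b) + ∑ b, σ i b * v b := by
      rw [← Finset.sum_add_distrib]; exact Finset.sum_congr rfl fun b _ => by ring
    rw [e1] at t1
    rw [e2]
    linear_combination (norm := skip) h' + t1
    ring_nf
    try reduce_mod_char
  obtain ⟨hγ, hx, hy⟩ := hF (fun b => u b + U0) (fun b => u b + v b) U0 hE1 hE2 T1 T2
  have hub : ∀ b, u b = 0 := fun b => by
    have := congrFun hx b; simp only [Pi.zero_apply] at this; rw [hγ, add_zero] at this; exact this
  have hvb : ∀ b, v b = 0 := fun b => by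
    have := congrFun hy b; simp only [Pi.zero_apply] at this; rw [hub b, zero_add] at this; exact this
  funext idx
  rcases idx with i | i
  · refine Fin.addCases (fun b => ?_) (fun j => ?_) i
    · exact hub b
    · rcases fin_cons_cases c₁ rest j with rfl | ⟨i', rfl⟩
      · exact hγ
      · rw [Pi.zero_apply]; exact (hcU i').trans hγ
  · refine Fin.addCases (fun b => ?_) (fun j => ?_) i
    · exact hvb b
    · rcases fin_cons_cases c₁ rest j with rfl | ⟨i', rfl⟩
      · exact hV00
      · rw [Pi.zero_apply]; exact (hcV i').trans hV00

end DesignCore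

end Summit.BirchSwinnertonDyer.BirchSwinnertonDyer.Theorems.SymbolicMonsky
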